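import Mathlib
import Literature.Analysis.FluidPDE.CompressibleEulerImplosionSonicAnalytic
import Literature.Analysis.FluidPDE.CompressibleEulerImplosionUniqueness
import HarnessLib

/-!
# Buckmaster–Cao-Labora–Gómez-Serrano at `γ = 5/3`: the sonic series on a disc of known radius, and local uniqueness

Companion of `CompressibleEulerImplosionSonicAnalytic` (Props. 2.2–2.3: the Taylor series `W^{(r)}(ξ) = Σ wₙ ξⁿ`,
`Z^{(r)}(ξ) = Σ zₙ ξⁿ` of the analytic branch through `P_s`, summed as `Wloc r`, `Zloc r`, which converge, are analytic
and solve (1.8) inside the crude Catalan radius `sonicRad r`). This file re-derives the same package on ANY disc on which a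
geometric coefficient bound `|wₙ|, |zₙ| ≤ K Mⁿ` is available — the input form produced by the kernel-certified majorant of
the pinned profile (`…SonicSeriesGrowthB`: `|wₙ|, |zₙ| ≤ 3·10ⁿ` on the shooting window, so `M = 10`):

* `hasSum_of_geom_bound`, `analyticAt_of_geom_bound` — a scalar power series `Σ aₙ xⁿ` with `|aₙ| ≤ K Mⁿ` on `M|x| < 1`;
* `Wloc_eqs_of_bound` — `D_W W′ = N_W` and `D_Z Z′ = N_Z` along `(Wloc r, Zloc r)` on the whole disc `M|ξ| < 1`
  (`r ∈ (r₃, r₄)`; identity theorem: the analytic defects vanish near `0` by `sonicSeries_spec'`);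
* `eqOn_of_field_local` — local uniqueness against an implicit solution given only on an interval: a solution of the
  resolved system (1.8) off the sonic lines on `(a, b)` and a differentiable solution of the multiplied system on `(a, b)`
  which agree at one time agree on `(a, b)` (the interval version of `eqOn_of_field_implicit` of
  `…OriginGermWindow2`).

[cite: BuckmasterCaolaboraGomezserrano2025, Prop. 1.6, Prop. 2.2, Prop. 2.3]
-/

noncomputable section

open Filter Set Metric Topology

namespace Literature.Analysis.FluidPDE

namespace BuckmasterCaolaboraGomezserrano2025

namespace Monatomic

namespace SonicSeries

/-! ### A scalar power series on a disc of known radius -/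

section Generic

variable {a : ℕ → ℝ} {K M : ℝ}

/-- `HasSum (aₙ xⁿ) (Σ' aₙ xⁿ)` on `M|x| < 1` from `|aₙ| ≤ K Mⁿ`. [folklore] -/
theorem hasSum_of_geom_bound (hM : 0 < M) (ha : ∀ n, |a n| ≤ K * M ^ n) {x : ℝ} (hx : M * |x| < 1) :
    HasSum (fun n => a n * x ^ n) (∑' n, a n * x ^ n) := by
  have hKnn : 0 ≤ K := by have := (abs_nonneg _).trans (ha 0); simpa using this
  have hs : Summable fun n => |a n * x ^ n| := by
    refine Summable.of_nonneg_of_le (fun n => abs_nonneg _) (fun n => ?_)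
      ((summable_geometric_of_lt_one (by positivity) hx).mul_left K)
    rw [abs_mul, abs_pow, mul_pow]
    calc |a n| * |x| ^ n ≤ K * M ^ n * |x| ^ n := by gcongr; exact ha n
      _ = K * (M ^ n * |x| ^ n) := by ring
  exact hs.of_abs.hasSum

/-- **Analyticity on the disc** `M|x| < 1` of `x ↦ Σ' aₙ xⁿ` from `|aₙ| ≤ K Mⁿ`. [folklore] -/
theorem analyticAt_of_geom_bound (hM : 0 < M) (ha : ∀ n, |a n| ≤ K * M ^ n) {x : ℝ} (hx : M * |x| < 1) :
    AnalyticAt ℝ (fun y => ∑' n, a n * y ^ n) x := by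
  -- adapted from `OriginSeries.analyticAt_profile_of_bound`
  have hKnn : 0 ≤ K := by have := (abs_nonneg _).trans (ha 0); simpa using this
  set q := FormalMultilinearSeries.ofScalars ℝ a with hq
  let Minv : NNReal := ⟨M⁻¹, inv_nonneg.mpr hM.le⟩
  have hrad : ((Minv : NNReal) : ENNReal) ≤ q.radius := by
    refine q.le_radius_of_bound K fun n => ?_
    rw [hq, FormalMultilinearSeries.ofScalars_norm, Real.norm_eq_abs]
    show |a n| * (M⁻¹) ^ n ≤ K
    calc |a n| * (M⁻¹) ^ n ≤ K * M ^ n * (M⁻¹) ^ n := by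
          gcongr; exact ha n
      _ = K := by rw [mul_assoc, ← mul_pow, mul_inv_cancel₀ hM.ne', one_pow, mul_one]
  have hMinv_pos : (0 : ENNReal) < ((Minv : NNReal) : ENNReal) := by
    have : (0 : NNReal) < Minv := by
      show (0 : ℝ) < M⁻¹
      exact inv_pos.mpr hM
    exact_mod_cast this
  have hps : HasFPowerSeriesOnBall q.sum q 0 ((Minv : NNReal) : ENNReal) :=
    (q.hasFPowerSeriesOnBall (hMinv_pos.trans_le hrad)).mono hMinv_pos hrad
  have hfun : q.sum = fun y => ∑' n, a n * y ^ n := by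
    show FormalMultilinearSeries.ofScalarsSum (E := ℝ) a = _
    rw [FormalMultilinearSeries.ofScalarsSum_eq_tsum]
    funext y
    refine tsum_congr fun n => ?_
    rw [smul_eq_mul, mul_comm]
  rw [← hfun]
  refine hps.analyticAt_of_mem ?_
  rw [Metric.eball_coe, Metric.mem_ball, Real.dist_eq, sub_zero]
  show |x| < M⁻¹
  calc |x| = M * |x| / M := by field_simp
    _ < 1 / M := div_lt_div_of_pos_right hx hM
    _ = M⁻¹ := one_div M

end Generic

/-! ### `(Wloc, Zloc)` on a disc of known radius -/

section Loc

variable {r K M : ℝ}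

/-- `HasSum (wₙ ξⁿ) (Wloc r ξ)` and `HasSum (zₙ ξⁿ) (Zloc r ξ)` on `M|ξ| < 1`.
[cite: BuckmasterCaolaboraGomezserrano2025, Prop. 2.3] -/
theorem hasSum_Wloc_Zloc_of_bound (hM : 0 < M) (hw : ∀ n, |w r n| ≤ K * M ^ n) (hz : ∀ n, |z r n| ≤ K * M ^ n)
    {ξ : ℝ} (hξ : M * |ξ| < 1) :
    HasSum (fun n => w r n * ξ ^ n) (Wloc r ξ) ∧ HasSum (fun n => z r n * ξ ^ n) (Zloc r ξ) :=
  ⟨hasSum_of_geom_bound hM hw hξ, hasSum_of_geom_bound hM hz hξ⟩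

/-- Analyticity of `Wloc r`, `Zloc r` on `M|ξ| < 1`. [cite: BuckmasterCaolaboraGomezserrano2025, Prop. 2.3] -/
theorem analyticAt_Wloc_Zloc_of_bound (hM : 0 < M) (hw : ∀ n, |w r n| ≤ K * M ^ n) (hz : ∀ n, |z r n| ≤ K * M ^ n)
    {ξ : ℝ} (hξ : M * |ξ| < 1) : AnalyticAt ℝ (Wloc r) ξ ∧ AnalyticAt ℝ (Zloc r) ξ := by
  rw [Wloc_def, Zloc_def]
  exact ⟨analyticAt_of_geom_bound hM hw hξ, analyticAt_of_geom_bound hM hz hξ⟩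

/-- **The branch equations on the disc of known radius.** For `r ∈ (r₃, r₄)`, `(Wloc r, Zloc r)` solves the multiplied
system (1.8) at every `ξ` with `M|ξ| < 1` (identity theorem from the tree's `sonicSeries_spec'` near `0`).
[cite: BuckmasterCaolaboraGomezserrano2025, Prop. 2.2, Prop. 2.3] -/
theorem Wloc_eqs_of_bound (h3 : r3 < r) (h4 : r < r4) (hM : 0 < M) (hw : ∀ n, |w r n| ≤ K * M ^ n)
    (hz : ∀ n, |z r n| ≤ K * M ^ n) {ξ : ℝ} (hξ : M * |ξ| < 1) :
    DW (Wloc r ξ) (Zloc r ξ) * deriv (Wloc r) ξ = NW r (Wloc r ξ) (Zloc r ξ) ∧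
      DZ (Wloc r ξ) (Zloc r ξ) * deriv (Zloc r) ξ = NZ r (Wloc r ξ) (Zloc r ξ) := by
  have hball : ∀ y ∈ Metric.ball (0 : ℝ) M⁻¹, M * |y| < 1 := by
    intro y hy
    rw [Metric.mem_ball, Real.dist_eq, sub_zero] at hy
    calc M * |y| < M * M⁻¹ := mul_lt_mul_of_pos_left hy hM
      _ = 1 := mul_inv_cancel₀ hM.ne'
  have hξball : ξ ∈ Metric.ball (0 : ℝ) M⁻¹ := by
    rw [Metric.mem_ball, Real.dist_eq, sub_zero]
    calc |ξ| = M * |ξ| / M := by field_simp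
      _ < 1 / M := div_lt_div_of_pos_right hξ hM
      _ = M⁻¹ := one_div M
  -- the analytic defects
  set FW : ℝ → ℝ := fun y => DW (Wloc r y) (Zloc r y) * deriv (Wloc r) y - NW r (Wloc r y) (Zloc r y) with hFW
  set FZ : ℝ → ℝ := fun y => DZ (Wloc r y) (Zloc r y) * deriv (Zloc r) y - NZ r (Wloc r y) (Zloc r y) with hFZ
  have han : ∀ y ∈ Metric.ball (0 : ℝ) M⁻¹, AnalyticAt ℝ FW y ∧ AnalyticAt ℝ FZ y := by
    intro y hy
    obtain ⟨hW, hZ⟩ := analyticAt_Wloc_Zloc_of_bound hM hw hz (hball y hy)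
    have hdW : AnalyticAt ℝ (deriv (Wloc r)) y := hW.deriv
    have hdZ : AnalyticAt ℝ (deriv (Zloc r)) y := hZ.deriv
    have hDW : AnalyticAt ℝ (fun y => DW (Wloc r y) (Zloc r y)) y := by
      unfold DW; exact analyticAt_const.add (((analyticAt_const.mul hW).add hZ).div_const)
    have hDZ : AnalyticAt ℝ (fun y => DZ (Wloc r y) (Zloc r y)) y := by
      unfold DZ; exact analyticAt_const.add ((hW.add (analyticAt_const.mul hZ)).div_const)
    have hNW : AnalyticAt ℝ (fun y => NW r (Wloc r y) (Zloc r y)) y := by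
      unfold NW
      exact (((analyticAt_const.add ((analyticAt_const.mul hW).div_const)).add (hZ.div_const)).neg.mul hW).add
        ((hZ.pow 2).div_const)
    have hNZ : AnalyticAt ℝ (fun y => NZ r (Wloc r y) (Zloc r y)) y := by
      unfold NZ
      exact (((analyticAt_const.add (hW.div_const)).add ((analyticAt_const.mul hZ).div_const)).neg.mul hZ).add
        ((hW.pow 2).div_const)
    exact ⟨(hDW.mul hdW).sub hNW, (hDZ.mul hdZ).sub hNZ⟩
  have hFWa : AnalyticOnNhd ℝ FW (Metric.ball (0 : ℝ) M⁻¹) := fun y hy => (han y hy).1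
  have hFZa : AnalyticOnNhd ℝ FZ (Metric.ball (0 : ℝ) M⁻¹) := fun y hy => (han y hy).2
  -- the defects vanish near `0`
  obtain ⟨-, -, -, -, hspec⟩ := sonicSeries_spec' h3 h4
  have hρ : 0 < sonicRad r := sonicRad_pos (h4.trans r3_r4_mem.2.2)
  have hnear : ∀ᶠ y in 𝓝 (0 : ℝ), |y| < sonicRad r := by
    have : Set.Iio (sonicRad r) ∈ 𝓝 (|(0 : ℝ)|) := by rw [abs_zero]; exact Iio_mem_nhds hρ
    exact continuous_abs.continuousAt.preimage_mem_nhds this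
  have hFW0 : FW =ᶠ[𝓝 (0 : ℝ)] 0 := by
    filter_upwards [hnear] with y hy
    have := (hspec y hy).2.2.1
    simp only [hFW, Pi.zero_apply]; linarith
  have hFZ0 : FZ =ᶠ[𝓝 (0 : ℝ)] 0 := by
    filter_upwards [hnear] with y hy
    have := (hspec y hy).2.2.2
    simp only [hFZ, Pi.zero_apply]; linarith
  have h0 : (0 : ℝ) ∈ Metric.ball (0 : ℝ) M⁻¹ := Metric.mem_ball_self (inv_pos.mpr hM)
  have hW0 := hFWa.eqOn_zero_of_preconnected_of_eventuallyEq_zero (convex_ball (0 : ℝ) M⁻¹).isPreconnected h0 hFW0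
  have hZ0 := hFZa.eqOn_zero_of_preconnected_of_eventuallyEq_zero (convex_ball (0 : ℝ) M⁻¹).isPreconnected h0 hFZ0
  have h1 : FW ξ = 0 := hW0 hξball
  have h2 : FZ ξ = 0 := hZ0 hξball
  simp only [hFW, hFZ] at h1 h2
  exact ⟨by linarith, by linarith⟩

end Loc

/-! ### Local uniqueness against an implicit solution on an interval -/

/-- **Uniqueness against an implicit solution given on an interval.** A solution `c₁` of the resolved system (1.8) on
`(a, b)` staying off the sonic lines there, and a pair `(W₂, Z₂)` differentiable on `(a, b)` satisfying the multiplied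
system `D_W W′ = N_W`, `D_Z Z′ = N_Z` on `(a, b)`, which agree at some `t₀ ∈ (a, b)`, agree on `(a, b)` (interval
version of `eqOn_of_field_implicit`). [cite: BuckmasterCaolaboraGomezserrano2025, Prop. 1.6] -/
theorem eqOn_of_field_local {r : ℝ} {c₁ : ℝ → ℝ × ℝ} {W₂ Z₂ : ℝ → ℝ} {a b t₀ : ℝ} (ht₀ : t₀ ∈ Set.Ioo a b)
    (h₁ : ∀ t ∈ Set.Ioo a b, HasDerivAt c₁ (field r (c₁ t)) t)
    (hD : ∀ t ∈ Set.Ioo a b, DW (c₁ t).1 (c₁ t).2 ≠ 0 ∧ DZ (c₁ t).1 (c₁ t).2 ≠ 0)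
    (hW₂ : ∀ t ∈ Set.Ioo a b, DifferentiableAt ℝ W₂ t) (hZ₂ : ∀ t ∈ Set.Ioo a b, DifferentiableAt ℝ Z₂ t)
    (h₂ : ∀ t ∈ Set.Ioo a b, DW (W₂ t) (Z₂ t) * deriv W₂ t = NW r (W₂ t) (Z₂ t) ∧
      DZ (W₂ t) (Z₂ t) * deriv Z₂ t = NZ r (W₂ t) (Z₂ t))
    (heq : c₁ t₀ = (W₂ t₀, Z₂ t₀)) : Set.EqOn c₁ (fun t => (W₂ t, Z₂ t)) (Set.Ioo a b) := by
  -- adapted from `OriginSeries.eqOn_of_field_implicit` (hypotheses on `(W₂, Z₂)` localised to the interval)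
  set c₂ : ℝ → ℝ × ℝ := fun t => (W₂ t, Z₂ t) with hc₂
  have hc₂cont : ∀ t ∈ Set.Ioo a b, ContinuousAt c₂ t :=
    fun t ht => (hW₂ t ht).continuousAt.prodMk (hZ₂ t ht).continuousAt
  have hev : ∀ t ∈ Set.Ioo a b, ∀ᶠ s in 𝓝 t, s ∈ Set.Ioo a b := fun t ht => isOpen_Ioo.mem_nhds ht
  -- where `c₂` is off the sonic lines (inside the interval) it solves the resolved system
  have hres : ∀ s ∈ Set.Ioo a b, DW (W₂ s) (Z₂ s) ≠ 0 → DZ (W₂ s) (Z₂ s) ≠ 0 → HasDerivAt c₂ (field r (c₂ s)) s := by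
    intro s hs hW hZ
    have hdW : deriv W₂ s = NW r (W₂ s) (Z₂ s) / DW (W₂ s) (Z₂ s) := by
      rw [eq_div_iff hW, mul_comm]; exact (h₂ s hs).1
    have hdZ : deriv Z₂ s = NZ r (W₂ s) (Z₂ s) / DZ (W₂ s) (Z₂ s) := by
      rw [eq_div_iff hZ, mul_comm]; exact (h₂ s hs).2
    have := ((hW₂ s hs).hasDerivAt.prodMk (hZ₂ s hs).hasDerivAt)
    rw [hdW, hdZ] at this
    exact this
  -- local resolved form near a point of agreement
  have hloc : ∀ t ∈ Set.Ioo a b, c₁ t = c₂ t → ∀ᶠ s in 𝓝 t, HasDerivAt c₂ (field r (c₂ s)) s := by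
    intro t ht hEq
    have hDt : DW (c₂ t).1 (c₂ t).2 ≠ 0 ∧ DZ (c₂ t).1 (c₂ t).2 ≠ 0 := by rw [← hEq]; exact hD t ht
    have hopen : IsOpen {p : ℝ × ℝ | DW p.1 p.2 ≠ 0 ∧ DZ p.1 p.2 ≠ 0} := by
      have hcW : Continuous fun p : ℝ × ℝ => DW p.1 p.2 := by unfold DW; fun_prop
      have hcZ : Continuous fun p : ℝ × ℝ => DZ p.1 p.2 := by unfold DZ; fun_prop
      exact (isOpen_ne_fun hcW continuous_const).inter (isOpen_ne_fun hcZ continuous_const)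
    have hev2 : ∀ᶠ s in 𝓝 t, c₂ s ∈ {p : ℝ × ℝ | DW p.1 p.2 ≠ 0 ∧ DZ p.1 p.2 ≠ 0} :=
      (hc₂cont t ht).preimage_mem_nhds (hopen.mem_nhds hDt)
    exact (hev2.and (hev t ht)).mono fun s hs => hres s hs.2 hs.1.1 hs.1.2
  -- the set of times near which the solutions agree
  set u : Set ℝ := {t | t ∈ Set.Ioo a b ∧ c₁ =ᶠ[𝓝 t] c₂} with hu
  have hd₁ : ∀ t ∈ Set.Ioo a b, ∀ᶠ s in 𝓝 t, HasDerivAt c₁ (field r (c₁ s)) s :=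
    fun t ht => (hev t ht).mono fun s hs => h₁ s hs
  have hu_open : IsOpen u := by
    rw [isOpen_iff_mem_nhds]
    rintro t ⟨ht, hte⟩
    have : ∀ᶠ s in 𝓝 t, c₁ =ᶠ[𝓝 s] c₂ := hte.eventually_nhds
    exact ((hev t ht).and this).mono fun s hs => hs
  have ht₀u : t₀ ∈ u := ⟨ht₀, eventuallyEq_of_field (hd₁ t₀ ht₀) (hloc t₀ ht₀ heq) (hD t₀ ht₀) heq⟩
  have hcl : closure u ∩ Set.Ioo a b ⊆ u := by
    rintro t ⟨htc, ht⟩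
    have hc₁ : ContinuousAt c₁ t := (h₁ t ht).continuousAt
    have hc₂t : ContinuousAt c₂ t := hc₂cont t ht
    have hEq : c₁ t = c₂ t := by
      have hmem : t ∈ closure {s | c₁ s = c₂ s} :=
        closure_mono (fun s hs => (hs.2 : c₁ =ᶠ[𝓝 s] c₂).eq_of_nhds) htc
      by_contra hne
      have hopen : IsOpen {p : (ℝ × ℝ) × (ℝ × ℝ) | p.1 ≠ p.2} := isOpen_ne_fun continuous_fst continuous_snd
      have : ∀ᶠ s in 𝓝 t, c₁ s ≠ c₂ s :=
        (hc₁.prodMk hc₂t).preimage_mem_nhds (hopen.mem_nhds hne)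
      obtain ⟨V, hV, hVsub⟩ : ∃ V ∈ 𝓝 t, ∀ s ∈ V, c₁ s ≠ c₂ s := eventually_iff_exists_mem.mp this
      obtain ⟨s, hsV, hs⟩ := mem_closure_iff_nhds.mp hmem V hV
      exact hVsub s hsV hs
    exact ⟨ht, eventuallyEq_of_field (hd₁ t ht) (hloc t ht hEq) (hD t ht) hEq⟩
  have hsub : Set.Ioo a b ⊆ u :=
    isPreconnected_Ioo.subset_of_closure_inter_subset hu_open ⟨t₀, ht₀, ht₀u⟩ hcl
  intro t ht
  exact ((hsub ht).2 : c₁ =ᶠ[𝓝 t] c₂).eq_of_nhds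

end SonicSeries

end Monatomic

end BuckmasterCaolaboraGomezserrano2025

end Literature.Analysis.FluidPDE
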